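import Summits.HubbardSuperconductivity.HubbardSuperconductivity.Theorems.LevyLogBootstrapDressHalfFilledInterHopColumns
import Literature.MathematicalPhysics.QuantumLattice.ClusterProductSliceCross
import Literature.MathematicalPhysics.QuantumLattice.TorusPlaquetteHamiltonian
import HarnessLib

/-!
# Route `LevyLogBootstrap` / `AnisotropyChord`, crux `DressHalfFilled` (stmt-HubbardSuperconductivity-8148), stub 2
# `stub_plaquetteDictionary`, clause (d) — step 2 of the inter-plaquette locality: hops on DIFFERENT bonds do not talk

Support file (`--supports stmt-HubbardSuperconductivity-8148`), continuing `…InterHopColumns` (step 1: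
`T col_σ = −Σ_{R,k} slice_{R,R+e_k}(ψ_σ) · hopVec_{R,k}`). Here:

* `plaqNbr_right_injective`, `plaqNbr_plaqNbr_ne` — on the plaquette torus `(ℤ/M)²` with `M ≥ 3`, distinct oriented
  bonds `(R, k) ≠ (R', k')` have distinct unordered supports `{R, R+e_k} ≠ {R', R'+e_k'}`
  (`exists_cluster_not_mem_bond`: some endpoint of one is not an endpoint of the other);
* `hopVec_ne_zero_imp` — the hop vector of a bond is supported on odd–odd basis pairs (a hop makes both plaquette
  factors odd);
* **`cross_bond_term_eq_zero`** — for distinct bonds the second-order term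
  `⟨slice_{b'}(ψ_σ') v', S_{H_in}(E₀) slice_b(ψ_σ) v_b⟩` vanishes for EVERY `v'` supported on odd–odd pairs: the
  reduced resolvent of the intra-plaquette Hamiltonian acts inside the slice
  (`ClusterProductSlice.reducedResolvent_mulVec_sliceMap_mulVec`, environment factors are plaquette eigenstates) and an
  odd factor of the bra faces an even environment factor of the ket (`ClusterProductSliceCross`).

References: W.-F. Tsai, S. A. Kivelson, PRB 73 (2006) 214510, App. A (A1) [TsaiKivelson2006]. No definition and no
named fact is introduced; all statements are [folklore].
-/

set_option linter.dupNamespace false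

noncomputable section

namespace Summit.HubbardSuperconductivity.HubbardSuperconductivity.Theorems.LevyLogBootstrap

open Matrix Literature.MathematicalPhysics.QuantumLattice Literature.Probability.LatticeModels
open Literature.MathematicalPhysics.QuantumLattice.TorusPlaquette TwoCluster

variable {M : ℕ} [NeZero M]

/-! ### Distinct bonds have distinct supports (`M ≥ 3`) -/

/-- `R + e_k = R + e_k'` forces `k = k'` (`M ≥ 2`). [folklore] -/
theorem plaqNbr_right_injective (hM : 2 ≤ M) (R : FermionTorus 2 M) {k k' : Fin 2}
    (h : plaqNbr R k = plaqNbr R k') : k = k' := by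
  by_contra hne
  have h1 : ((ofLex (plaqNbr R k) k : Fin M) : ℕ) = (ofLex (plaqNbr R k') k : ℕ) := by rw [h]
  rw [val_plaqNbr_same, plaqNbr_apply_of_ne R hne] at h1
  have hc := (ofLex R k).isLt
  rcases Nat.lt_or_ge ((ofLex R k : ℕ) + 1) M with hlt | hge
  · rw [Nat.mod_eq_of_lt hlt] at h1; omega
  · have heq : (ofLex R k : ℕ) + 1 = M := by omega
    rw [heq, Nat.mod_self] at h1; omega

/-- `(R + e_k) + e_k' ≠ R` (`M ≥ 3`). [folklore] -/
theorem plaqNbr_plaqNbr_ne (hM : 3 ≤ M) (R : FermionTorus 2 M) (k k' : Fin 2) : plaqNbr (plaqNbr R k) k' ≠ R := by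
  intro h
  have h1 : ((ofLex (plaqNbr (plaqNbr R k) k') k : Fin M) : ℕ) = (ofLex R k : ℕ) := by rw [h]
  have hc := (ofLex R k).isLt
  by_cases hk : k = k'
  · subst hk
    rw [val_plaqNbr_same, val_plaqNbr_same] at h1
    rcases Nat.lt_or_ge ((ofLex R k : ℕ) + 1) M with hlt | hge
    · rw [Nat.mod_eq_of_lt hlt] at h1
      rcases Nat.lt_or_ge ((ofLex R k : ℕ) + 1 + 1) M with hlt2 | hge2
      · rw [Nat.mod_eq_of_lt hlt2] at h1; omega
      · have heq : (ofLex R k : ℕ) + 1 + 1 = M := by omega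
        rw [heq, Nat.mod_self] at h1; omega
    · have heq : (ofLex R k : ℕ) + 1 = M := by omega
      rw [heq, Nat.mod_self, zero_add, Nat.mod_eq_of_lt (by omega : 1 < M)] at h1
      omega
  · rw [plaqNbr_apply_of_ne _ hk, val_plaqNbr_same] at h1
    rcases Nat.lt_or_ge ((ofLex R k : ℕ) + 1) M with hlt | hge
    · rw [Nat.mod_eq_of_lt hlt] at h1; omega
    · have heq : (ofLex R k : ℕ) + 1 = M := by omega
      rw [heq, Nat.mod_self] at h1; omega

/-- **Distinct oriented bonds have distinct supports** (`M ≥ 3`): if `(R', k') ≠ (R, k)`, some endpoint of the bond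
`{R', R'+e_k'}` is not an endpoint of `{R, R+e_k}`. [folklore] -/
theorem exists_cluster_not_mem_bond (hM : 3 ≤ M) {R R' : FermionTorus 2 M} {k k' : Fin 2}
    (hne : (R', k') ≠ (R, k)) :
    ∃ c₀ : FermionTorus 2 M, (c₀ = R' ∨ c₀ = plaqNbr R' k') ∧ c₀ ≠ R ∧ c₀ ≠ plaqNbr R k := by
  have hM2 : 2 ≤ M := by omega
  by_cases h1 : R' = R ∨ R' = plaqNbr R k
  · by_cases h2 : plaqNbr R' k' = R ∨ plaqNbr R' k' = plaqNbr R k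
    · exfalso
      rcases h1 with h1 | h1
      · -- `R' = R`: then `R + e_k' ∈ {R, R + e_k}` forces `k' = k`
        rw [h1] at h2 hne
        rcases h2 with h2 | h2
        · exact plaqNbr_ne hM2 R k' h2
        · exact hne (by rw [plaqNbr_right_injective hM2 R h2])
      · -- `R' = R + e_k`: then `R' + e_k' ∈ {R, R + e_k}` is impossible
        rw [h1] at h2
        rcases h2 with h2 | h2
        · exact plaqNbr_plaqNbr_ne hM R k k' h2
        · exact plaqNbr_ne hM2 _ k' h2
    · push Not at h2
      exact ⟨plaqNbr R' k', Or.inr rfl, h2.1, h2.2⟩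
  · push Not at h1
    exact ⟨R', Or.inl rfl, h1.1, h1.2⟩

/-! ### The hop vector is odd–odd -/

/-- The hop vector of the bond `(R, R + e_k)` on the column `σ` is supported on odd–odd basis pairs. [folklore] -/
theorem hopVec_ne_zero_imp (U : ℝ) (σ : TensorIndex (TorusSite 2 M) 2) (R : FermionTorus 2 M) (k : Fin 2)
    (B : Finset (PlaquetteSite × PlaquetteSite)) (ε₁ ε₂ : ℂ) :
    ∀ p : Finset (Orb PlaquetteSite) × Finset (Orb PlaquetteSite),
      (∑ q ∈ B, ∑ s : Fin 2,
          (ε₁ • tensorVec (creation (orb q.1 s) *ᵥ plaqFamily U σ R)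
              (annihilation (orb q.2 s) *ᵥ plaqFamily U σ (plaqNbr R k)) +
            ε₂ • tensorVec (annihilation (orb q.1 s) *ᵥ plaqFamily U σ R)
              (creation (orb q.2 s) *ᵥ plaqFamily U σ (plaqNbr R k)))) p ≠ 0 →
        p.1.card % 2 = 1 ∧ p.2.card % 2 = 1 := by
  intro p hp
  rw [Finset.sum_apply] at hp
  obtain ⟨q, -, hq⟩ := Finset.exists_ne_zero_of_sum_ne_zero hp
  rw [Finset.sum_apply] at hq
  obtain ⟨s, -, hs⟩ := Finset.exists_ne_zero_of_sum_ne_zero hq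
  rw [Pi.add_apply, Pi.smul_apply, Pi.smul_apply, smul_eq_mul, smul_eq_mul] at hs
  have hR := hasParity_plaqFamily U σ R
  have hN := hasParity_plaqFamily U σ (plaqNbr R k)
  by_cases h1 : tensorVec (creation (orb q.1 s) *ᵥ plaqFamily U σ R)
      (annihilation (orb q.2 s) *ᵥ plaqFamily U σ (plaqNbr R k)) p ≠ 0
  · exact HasParity.tensorVec_ne_zero_imp (hR.creation_mulVec _) (hN.annihilation_mulVec _) p h1
  · rw [not_not] at h1
    rw [h1, mul_zero, zero_add] at hs
    exact HasParity.tensorVec_ne_zero_imp (hR.annihilation_mulVec _) (hN.creation_mulVec _) p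
      (right_ne_zero_of_mul hs)

/-! ### Cross terms vanish -/

/-- **Hops on different bonds do not talk at second order** (`M ≥ 3`): for oriented bonds `(R', k') ≠ (R, k)`, any
`v'` supported on odd–odd basis pairs (e.g. a hop vector, `hopVec_ne_zero_imp`) and any `v`,
`⟨slice_{R',R'+e_k'}(ψ_σ') v', S_{H_in}(E₀) slice_{R,R+e_k}(ψ_σ) v⟩ = 0`. [cite: TsaiKivelson2006, App. A (A1)] -/
theorem cross_bond_term_eq_zero (hM : 3 ≤ M) (U : ℝ) (σ' σ : TensorIndex (TorusSite 2 M) 2)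
    {R R' : FermionTorus 2 M} {k k' : Fin 2} (hne : (R', k') ≠ (R, k)) (E₀ : ℝ)
    {v' : Finset (Orb PlaquetteSite) × Finset (Orb PlaquetteSite) → ℂ}
    (hv' : ∀ p, v' p ≠ 0 → p.1.card % 2 = 1 ∧ p.2.card % 2 = 1)
    (v : Finset (Orb PlaquetteSite) × Finset (Orb PlaquetteSite) → ℂ) :
    star ((plaquettePartition M).sliceMap (plaqFamily U σ') R' (plaqNbr R' k') *ᵥ v') ⬝ᵥ
      (reducedResolvent (hamiltonian (fermionTorusGraph 2 (2 * M) \ SimpleGraph.comap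
          (fun x : FermionTorus 2 (2 * M) => fun i : Fin 2 => ((ofLex x) i : ℕ) / 2) ⊤) 1 U) E₀ *ᵥ
        ((plaquettePartition M).sliceMap (plaqFamily U σ) R (plaqNbr R k) *ᵥ v)) = 0 := by
  have hM2 : 2 ≤ M := by omega
  -- the intra-plaquette Hamiltonian is the sum of the embedded plaquette Hamiltonians over the partition
  have hsum : hamiltonian (fermionTorusGraph 2 (2 * M) \ SimpleGraph.comap
      (fun x : FermionTorus 2 (2 * M) => fun i : Fin 2 => ((ofLex x) i : ℕ) / 2) ⊤) 1 U =
      ∑ c : FermionTorus 2 M, jwEmbed ((plaquettePartition M).emb c)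
        ((fun _ : FermionTorus 2 M => plaquetteHamiltonian U) c) := by
    simpa only [plaquettePartition_emb] using hamiltonian_intra_eq_sum_jwEmbed_plaquetteHamiltonian hM2 U
  -- the environment factors are eigenvectors of their plaquette Hamiltonians
  have hψ : ∀ c : FermionTorus 2 M, c ≠ R → c ≠ plaqNbr R k →
      (fun _ : FermionTorus 2 M => plaquetteHamiltonian U) c *ᵥ plaqFamily U σ c =
        (((fun c : FermionTorus 2 M =>
            plaquetteEnergy U (2 * ((Fin.rev (σ (FermionTorus.toTorusSite c)) : Fin 2) : ℕ))) c : ℝ) : ℂ) •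
          plaqFamily U σ c :=
    fun c _ _ => plaquetteHamiltonian_mulVec_plaquetteStates U _
  -- the reduced resolvent acts inside the ket slice
  have key := (plaquettePartition M).reducedResolvent_mulVec_sliceMap_mulVec (plaqNbr_ne hM2 R k).symm
    (A := fun _ : FermionTorus 2 M => plaquetteHamiltonian U) (fun _ => isParityPreserving_plaquetteHamiltonian U)
    (fun _ => plaquetteHamiltonian_isHermitian U) (LiebThm1.hamiltonian_isHermitian _ 1 U) hsum (plaqFamily U σ)
    hψ E₀ v
  -- transport along the bra and kill the slice-to-slice overlap: an endpoint of the bra bond outside the ket bond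
  -- carries an even ket factor facing an odd bra factor
  have h2 := congrArg
    (fun w => star ((plaquettePartition M).sliceMap (plaqFamily U σ') R' (plaqNbr R' k') *ᵥ v') ⬝ᵥ w) key
  obtain ⟨c₀, hc₀, h₁, h₂⟩ := exists_cluster_not_mem_bond hM hne
  simp only [(plaquettePartition M).star_sliceMap_mulVec_dotProduct_sliceMap_mulVec_eq_zero
    (plaqNbr_ne hM2 R' k').symm hc₀ h₁ h₂ (plaqFamily U σ') (hasParity_plaqFamily U σ c₀) hv'] at h2
  -- `h2` carries the generic `DecidableEq` instances of the `ClusterProductSlice` lemmas inside `reducedResolvent`;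
  -- the statement's instances are the default ones of this context: `convert` closes the (subsingleton) difference
  convert h2 using 4

end Summit.HubbardSuperconductivity.HubbardSuperconductivity.Theorems.LevyLogBootstrap

end
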